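import Summits.Ventures.CertifiedManyBodySolver.Downfold.EmeryOrbitalWeightFaceDirBox
import Summits.Ventures.CertifiedManyBodySolver.Downfold.EmeryOrbitalWeightFaceDirCertW
import Summits.Ventures.CertifiedManyBodySolver.Downfold.EmeryVanHoveSubBox
import Summits.Ventures.CertifiedManyBodySolver.Downfold.EmeryVanHoveTableA
import Summits.Ventures.CertifiedManyBodySolver.Downfold.EmeryVanHoveTableE
import Summits.Ventures.CertifiedManyBodySolver.Downfold.EmeryVanHoveTableG
import Summits.Ventures.CertifiedManyBodySolver.Downfold.EmeryVanHoveTableI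
import Summits.Ventures.CertifiedManyBodySolver.Downfold.EmeryFermiFaceDirPointsNCCOK26NH085S1
import Summits.Ventures.CertifiedManyBodySolver.Downfold.EmeryFermiFaceDirPointsNCCOK26NH085S2
import Summits.Ventures.CertifiedManyBodySolver.Downfold.EmeryFermiFaceDirPointsNCCOK26NH085S3
import Summits.Ventures.CertifiedManyBodySolver.Downfold.EmeryFermiFaceDirPointsNCCOK26NH085S4
import HarnessLib

/-!
# THE ANTINODAL FERMI-SURFACE Cu-d WEIGHT OVER THE TYPED 3BE BOX `emeryBoxNCCOK26Src (EmeryBoxesKSlicesB)` AT FILLING n_H = 0.85 (ν = 23/40), regime-free rule v2 — the kinematic leg of the UPPER member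
# `U_B∣full(w_antinode)` of the weak band-level `U` bracket read over a box where the v1 rule's antinodal charge-transfer regime FAILS at the low-Δ corners
# (INFL-3to1-B §B.91 (h): the §B.90 (j) device on the WIDE certificate window `EmeryOrbitalWeightFaceDirCertW` (ε/t_pd ≤ 11/5); router/EMERY-FS-WEIGHT-BRACKETS.tsv)

Venture CertifiedManyBodySolver, cell `pub/hubbard-downfold` (stage S1), seat hubbard-downfold-mod-4 (technique B, g40); namespace
`Summit.Ventures.CertifiedManyBodySolver.Downfold.Emery`. Everything PROVED (0 sorry). WHAT THIS IS NOT: a statement about the material — the typed box (Nd₂₋ₓCeₓCuO₄ x = 0.15 (electron-doped; (K) #24 source box))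
is SCREENING-GRADE; `U = 0` one-body kinematics of the σ model; the `U_B` arithmetic that consumes the window is DERIVED context on the MEAN-FIELD annex (R-B17).

For every member θ = (Δ, t_pd, t_pp, t_pp′) ∈ [1, 2.05] × [0.9, 1.29] × [0.52, 0.72] × [0.02, 0.02] eV at filling ν = 23/40, the Cu-d weight of the ANTINODAL Bloch state,
`dWeightFace θ (fermiEnergyOf θ ν)`, lies in the window below. DEVICE (v2): `W(θ) = W(Δ/t_pd, 1, t_pp/t_pd, t_pp′/t_pd)` (scaling law); the t_pd range is cut into 4 slabs; on each
normalised slab the v2 CORNER RULE `dWeightFace_fermiEnergyOf_mem_Icc_of_mem_box3_dir_num`: Δ ↑ at fixed filling WITHOUT the regime (region-wide directional certificate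
`faceDirW_nonneg_of_mem_region` (ε/t_pd ≤ 11/5), κ₀ = 1/10, + the Fermi-energy slope law κ = 1/10 + mean value theorem), t_pp ↓, t_pp′ ↑ only at the upper corner (regime margin R2 there),
lower end `t_pp′`-decoupled (`dWeightFaceLoDec` at `E_h`); hole-likeness from the slab's `vhBoxCheck` + the Ψ table; two K = 384 Fermi-energy brackets per slab
(`EmeryFermiFaceDirPointsNCCOK26NH085S<k>`). The slab corners are VIRTUAL (not members): the window is a sound ENCLOSURE (lower end ≈ 0.02 below the v1 virtual-corner value).

| t_pd slab (eV) | normalised slab Δ/t_pd × t_pp/t_pd × t_pp′/t_pd | q₁ (vhBoxCheck) ≥ table point | E_h | E_v | margins (R2, 1 − κ − w̄_axis) | **w_face window** |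
|---|---|---|---|---|---|---|
| [0.9, 0.96] | [1.042, 2.278] × [0.5417, 0.8] × [0.02083, 0.02222] | 0.4372 ≥ 87/200 (Ψ ≤ 0.4019) | 2.163 | 1.4351 | +1.457, +0.171 | **[0.4854, 0.6838]** |
| [0.96, 1.05] | [0.9524, 2.135] × [0.4952, 0.75] × [0.01905, 0.02083] | 0.4065 ≥ 2/5 (Ψ ≤ 0.4071) | 2.1677 | 1.4589 | +1.530, +0.182 | **[0.4845, 0.6767]** |
| [1.05, 1.16] | [0.8621, 1.952] × [0.4483, 0.6857] × [0.01724, 0.01905] | 0.3781 ≥ 73/200 (Ψ ≤ 0.4124) | 2.159 | 1.4982 | +1.581, +0.196 | **[0.487, 0.665]** |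
| [1.16, 1.29] | [0.7752, 1.767] × [0.4031, 0.6207] × [0.0155, 0.01724] | 0.3495 ≥ 1/3 (Ψ ≤ 0.4176) | 2.1505 | 1.5397 | +1.626, +0.211 | **[0.4895, 0.6525]** |
| **whole box** | (hull of the slabs) | | | | | **[0.4845, 0.6838]** |

Sources: three-band model [HybertsenSchluterChristensen1989, Eq. (1)]; face point of the bilinear contour [AndersenEtAl1995, §6]; [folklore] algebra.
-/

noncomputable section

namespace Summit.Ventures.CertifiedManyBodySolver.Downfold.Emery

open Real Set

/-- **Slab 1 (t_pd ∈ [0.9, 0.96] eV) of `emeryBoxNCCOK26Src (EmeryBoxesKSlicesB)`, ν = 23/40: the antinodal Fermi-surface Cu-d weight of every member lies in `[0.4854, 0.6838]`**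
(normalised-slab v2 corner rule; brackets `faceDirPt_NCCOK26_nH085_s1_lo_br` / `_hi_br`). [folklore] -/
theorem nCCOK26Box_dWeightFaceDir_nH085_s1 {Δ a b c : ℝ} (hΔ : Δ ∈ Icc (1 : ℝ) ((41 : ℝ) / 20)) (ha : a ∈ Icc ((9 : ℝ) / 10) ((24 : ℝ) / 25)) (hb : b ∈ Icc ((13 : ℝ) / 25) ((18 : ℝ) / 25)) (hc : c ∈ Icc ((1 : ℝ) / 50) ((1 : ℝ) / 50)) :
    dWeightFace Δ a b c (fermiEnergyOf Δ a b c ((23 : ℝ) / 40)) ∈ Icc ((2427 : ℝ) / 5000) ((3419 : ℝ) / 5000) := by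
  have ha0 : 0 < a := lt_of_lt_of_le (by norm_num) ha.1
  rw [dWeightFace_fermiEnergyOf_eq_ratios ha0]
  have hΔn : Δ / a ∈ Icc ((25 : ℝ) / 24) ((41 : ℝ) / 18) := by
    constructor
    · rw [le_div_iff₀ ha0]; linarith [hΔ.1, ha.2]
    · rw [div_le_iff₀ ha0]; linarith [hΔ.2, ha.1]
  have hbn : b / a ∈ Icc ((13 : ℝ) / 24) ((4 : ℝ) / 5) := by
    constructor
    · rw [le_div_iff₀ ha0]; linarith [hb.1, ha.2]
    · rw [div_le_iff₀ ha0]; linarith [hb.2, ha.1]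
  have hcn : c / a ∈ Icc ((1 : ℝ) / 48) ((1 : ℝ) / 45) := by
    constructor
    · rw [le_div_iff₀ ha0]; linarith [hc.1, ha.2]
    · rw [div_le_iff₀ ha0]; linarith [hc.2, ha.1]
  have hVH : ∀ Δ' b' c' : ℝ, Δ' ∈ Icc ((25 : ℝ) / 24) ((41 : ℝ) / 18) → b' ∈ Icc ((13 : ℝ) / 24) ((4 : ℝ) / 5) → c' ∈ Icc ((1 : ℝ) / 48) ((1 : ℝ) / 45) →
      1 - 2 * ((23 : ℝ) / 40) ≤ xVH Δ' 1 b' c' := by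
    intro Δ' b' c' hΔ' hb' hc'
    have h := xVH_window_of_vhBoxCheck (Δ₁ := ((25 : ℚ) / 24)) (Δ₂ := ((41 : ℚ) / 18)) (a₁ := (1 : ℚ)) (a₂ := (1 : ℚ)) (b₁ := ((13 : ℚ) / 24)) (b₂ := ((4 : ℚ) / 5))
      (c₁ := ((1 : ℚ) / 48)) (c₂ := ((1 : ℚ) / 45)) (v₁ := ((2281 : ℚ) / 2000)) (v₂ := ((15151 : ℚ) / 10000)) (e := ((1513 : ℚ) / 1000)) (E := ((11419 : ℚ) / 10000))
      (q₁ := ((1093 : ℚ) / 2500)) (q₂ := ((10581 : ℚ) / 10000)) (by decide +kernel)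
      (Δ := Δ') (tpd := 1) (tpp := b') (c := c') (by simpa using hΔ') (by simp) (by simpa using hb') (by simpa using hc')
    obtain ⟨-, -, -, -, -, hwin⟩ := h
    push_cast at hwin
    have ht := vhFrac_87_200
    have hmono := vhFrac_anti (show (87 / 200 : ℝ) ≤ ((1093 : ℝ) / 2500) by norm_num)
    have hnu : ((59268 : ℝ) / 147456) ≤ ((23 : ℝ) / 40) := by norm_num
    linarith [hwin.1, ht.2]
  have hEh := (fermiEnergyOf_of_pointBracketCheck faceDirPt_NCCOK26_nH085_s1_lo_br (by norm_num) (by norm_num) (by norm_num) (ν := (23/40 : ℝ))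
    (by push_cast; exact ⟨le_rfl, le_rfl⟩)).2
  have hEv := (fermiEnergyOf_of_pointBracketCheck faceDirPt_NCCOK26_nH085_s1_hi_br (by norm_num) (by norm_num) (by norm_num) (ν := (23/40 : ℝ))
    (by push_cast; exact ⟨le_rfl, le_rfl⟩)).2
  push_cast at hEh hEv
  refine dWeightFace_fermiEnergyOf_mem_Icc_of_mem_box3_dir_num (Eh := ((2163 : ℝ) / 1000)) (Ev := ((14351 : ℝ) / 10000)) (Elow := ((14251 : ℝ) / 10000)) (κ₀ := 1 / 10) (κ := 1 / 10)
    (by norm_num) one_pos (by norm_num) (by norm_num) (by norm_num) hΔn hbn hcn (by norm_num) (by norm_num) hVH hEh.2 (by norm_num)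
    (by norm_num [faceU, fsD, fsN, cA]) (by norm_num [faceU, fsD, fsN, cA]) (by norm_num [faceU, fsD, fsN, cA]) (by norm_num [faceU, fsD, fsN, cA])
    hEv.1 (by norm_num) (by norm_num) (by norm_num [faceG]) (by norm_num) (by norm_num) (by norm_num) le_rfl (by norm_num [dWeightAxisCF])
    (by norm_num) (by norm_num) ?_ (by norm_num [dWeightFaceLoDec, faceRUp, faceN]) (by norm_num [dWeightFaceCF, faceN, faceR, fsN])
  intro D B C e hD hB hC he hG
  exact faceDirW_nonneg_of_mem_region ⟨le_trans (by norm_num) hD.1, le_trans hD.2 (by norm_num)⟩ ⟨le_trans (by norm_num) he.1, le_trans he.2 (by norm_num)⟩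
    ⟨le_trans (by norm_num) hB.1, le_trans hB.2 (by norm_num)⟩ ⟨le_trans (by norm_num) hC.1, le_trans hC.2 (by norm_num)⟩ hG

/-- **Slab 2 (t_pd ∈ [0.96, 1.05] eV) of `emeryBoxNCCOK26Src (EmeryBoxesKSlicesB)`, ν = 23/40: the antinodal Fermi-surface Cu-d weight of every member lies in `[0.4845, 0.6767]`**
(normalised-slab v2 corner rule; brackets `faceDirPt_NCCOK26_nH085_s2_lo_br` / `_hi_br`). [folklore] -/
theorem nCCOK26Box_dWeightFaceDir_nH085_s2 {Δ a b c : ℝ} (hΔ : Δ ∈ Icc (1 : ℝ) ((41 : ℝ) / 20)) (ha : a ∈ Icc ((24 : ℝ) / 25) ((21 : ℝ) / 20)) (hb : b ∈ Icc ((13 : ℝ) / 25) ((18 : ℝ) / 25)) (hc : c ∈ Icc ((1 : ℝ) / 50) ((1 : ℝ) / 50)) :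
    dWeightFace Δ a b c (fermiEnergyOf Δ a b c ((23 : ℝ) / 40)) ∈ Icc ((969 : ℝ) / 2000) ((6767 : ℝ) / 10000) := by
  have ha0 : 0 < a := lt_of_lt_of_le (by norm_num) ha.1
  rw [dWeightFace_fermiEnergyOf_eq_ratios ha0]
  have hΔn : Δ / a ∈ Icc ((20 : ℝ) / 21) ((205 : ℝ) / 96) := by
    constructor
    · rw [le_div_iff₀ ha0]; linarith [hΔ.1, ha.2]
    · rw [div_le_iff₀ ha0]; linarith [hΔ.2, ha.1]
  have hbn : b / a ∈ Icc ((52 : ℝ) / 105) ((3 : ℝ) / 4) := by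
    constructor
    · rw [le_div_iff₀ ha0]; linarith [hb.1, ha.2]
    · rw [div_le_iff₀ ha0]; linarith [hb.2, ha.1]
  have hcn : c / a ∈ Icc ((2 : ℝ) / 105) ((1 : ℝ) / 48) := by
    constructor
    · rw [le_div_iff₀ ha0]; linarith [hc.1, ha.2]
    · rw [div_le_iff₀ ha0]; linarith [hc.2, ha.1]
  have hVH : ∀ Δ' b' c' : ℝ, Δ' ∈ Icc ((20 : ℝ) / 21) ((205 : ℝ) / 96) → b' ∈ Icc ((52 : ℝ) / 105) ((3 : ℝ) / 4) → c' ∈ Icc ((2 : ℝ) / 105) ((1 : ℝ) / 48) →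
      1 - 2 * ((23 : ℝ) / 40) ≤ xVH Δ' 1 b' c' := by
    intro Δ' b' c' hΔ' hb' hc'
    have h := xVH_window_of_vhBoxCheck (Δ₁ := ((20 : ℚ) / 21)) (Δ₂ := ((205 : ℚ) / 96)) (a₁ := (1 : ℚ)) (a₂ := (1 : ℚ)) (b₁ := ((52 : ℚ) / 105)) (b₂ := ((3 : ℚ) / 4))
      (c₁ := ((2 : ℚ) / 105)) (c₂ := ((1 : ℚ) / 48)) (v₁ := ((11777 : ℚ) / 10000)) (v₂ := ((3877 : ℚ) / 2500)) (e := ((387 : ℚ) / 250)) (E := ((2949 : ℚ) / 2500))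
      (q₁ := ((813 : ℚ) / 2000)) (q₂ := ((623 : ℚ) / 625)) (by decide +kernel)
      (Δ := Δ') (tpd := 1) (tpp := b') (c := c') (by simpa using hΔ') (by simp) (by simpa using hb') (by simpa using hc')
    obtain ⟨-, -, -, -, -, hwin⟩ := h
    push_cast at hwin
    have ht := vhFrac_2_5
    have hmono := vhFrac_anti (show (2 / 5 : ℝ) ≤ ((813 : ℝ) / 2000) by norm_num)
    have hnu : ((60024 : ℝ) / 147456) ≤ ((23 : ℝ) / 40) := by norm_num
    linarith [hwin.1, ht.2]
  have hEh := (fermiEnergyOf_of_pointBracketCheck faceDirPt_NCCOK26_nH085_s2_lo_br (by norm_num) (by norm_num) (by norm_num) (ν := (23/40 : ℝ))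
    (by push_cast; exact ⟨le_rfl, le_rfl⟩)).2
  have hEv := (fermiEnergyOf_of_pointBracketCheck faceDirPt_NCCOK26_nH085_s2_hi_br (by norm_num) (by norm_num) (by norm_num) (ν := (23/40 : ℝ))
    (by push_cast; exact ⟨le_rfl, le_rfl⟩)).2
  push_cast at hEh hEv
  refine dWeightFace_fermiEnergyOf_mem_Icc_of_mem_box3_dir_num (Eh := ((21677 : ℝ) / 10000)) (Ev := ((14589 : ℝ) / 10000)) (Elow := ((14489 : ℝ) / 10000)) (κ₀ := 1 / 10) (κ := 1 / 10)
    (by norm_num) one_pos (by norm_num) (by norm_num) (by norm_num) hΔn hbn hcn (by norm_num) (by norm_num) hVH hEh.2 (by norm_num)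
    (by norm_num [faceU, fsD, fsN, cA]) (by norm_num [faceU, fsD, fsN, cA]) (by norm_num [faceU, fsD, fsN, cA]) (by norm_num [faceU, fsD, fsN, cA])
    hEv.1 (by norm_num) (by norm_num) (by norm_num [faceG]) (by norm_num) (by norm_num) (by norm_num) le_rfl (by norm_num [dWeightAxisCF])
    (by norm_num) (by norm_num) ?_ (by norm_num [dWeightFaceLoDec, faceRUp, faceN]) (by norm_num [dWeightFaceCF, faceN, faceR, fsN])
  intro D B C e hD hB hC he hG
  exact faceDirW_nonneg_of_mem_region ⟨le_trans (by norm_num) hD.1, le_trans hD.2 (by norm_num)⟩ ⟨le_trans (by norm_num) he.1, le_trans he.2 (by norm_num)⟩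
    ⟨le_trans (by norm_num) hB.1, le_trans hB.2 (by norm_num)⟩ ⟨le_trans (by norm_num) hC.1, le_trans hC.2 (by norm_num)⟩ hG

/-- **Slab 3 (t_pd ∈ [1.05, 1.16] eV) of `emeryBoxNCCOK26Src (EmeryBoxesKSlicesB)`, ν = 23/40: the antinodal Fermi-surface Cu-d weight of every member lies in `[0.487, 0.665]`**
(normalised-slab v2 corner rule; brackets `faceDirPt_NCCOK26_nH085_s3_lo_br` / `_hi_br`). [folklore] -/
theorem nCCOK26Box_dWeightFaceDir_nH085_s3 {Δ a b c : ℝ} (hΔ : Δ ∈ Icc (1 : ℝ) ((41 : ℝ) / 20)) (ha : a ∈ Icc ((21 : ℝ) / 20) ((29 : ℝ) / 25)) (hb : b ∈ Icc ((13 : ℝ) / 25) ((18 : ℝ) / 25)) (hc : c ∈ Icc ((1 : ℝ) / 50) ((1 : ℝ) / 50)) :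
    dWeightFace Δ a b c (fermiEnergyOf Δ a b c ((23 : ℝ) / 40)) ∈ Icc ((487 : ℝ) / 1000) ((133 : ℝ) / 200) := by
  have ha0 : 0 < a := lt_of_lt_of_le (by norm_num) ha.1
  rw [dWeightFace_fermiEnergyOf_eq_ratios ha0]
  have hΔn : Δ / a ∈ Icc ((25 : ℝ) / 29) ((41 : ℝ) / 21) := by
    constructor
    · rw [le_div_iff₀ ha0]; linarith [hΔ.1, ha.2]
    · rw [div_le_iff₀ ha0]; linarith [hΔ.2, ha.1]
  have hbn : b / a ∈ Icc ((13 : ℝ) / 29) ((24 : ℝ) / 35) := by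
    constructor
    · rw [le_div_iff₀ ha0]; linarith [hb.1, ha.2]
    · rw [div_le_iff₀ ha0]; linarith [hb.2, ha.1]
  have hcn : c / a ∈ Icc ((1 : ℝ) / 58) ((2 : ℝ) / 105) := by
    constructor
    · rw [le_div_iff₀ ha0]; linarith [hc.1, ha.2]
    · rw [div_le_iff₀ ha0]; linarith [hc.2, ha.1]
  have hVH : ∀ Δ' b' c' : ℝ, Δ' ∈ Icc ((25 : ℝ) / 29) ((41 : ℝ) / 21) → b' ∈ Icc ((13 : ℝ) / 29) ((24 : ℝ) / 35) → c' ∈ Icc ((1 : ℝ) / 58) ((2 : ℝ) / 105) →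
      1 - 2 * ((23 : ℝ) / 40) ≤ xVH Δ' 1 b' c' := by
    intro Δ' b' c' hΔ' hb' hc'
    have h := xVH_window_of_vhBoxCheck (Δ₁ := ((25 : ℚ) / 29)) (Δ₂ := ((41 : ℚ) / 21)) (a₁ := (1 : ℚ)) (a₂ := (1 : ℚ)) (b₁ := ((13 : ℚ) / 29)) (b₂ := ((24 : ℚ) / 35))
      (c₁ := ((1 : ℚ) / 58)) (c₂ := ((2 : ℚ) / 105)) (v₁ := ((6141 : ℚ) / 5000)) (v₂ := ((397 : ℚ) / 250)) (e := ((15851 : ℚ) / 10000)) (E := ((6151 : ℚ) / 5000))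
      (q₁ := ((3781 : ℚ) / 10000)) (q₂ := ((4539 : ℚ) / 5000)) (by decide +kernel)
      (Δ := Δ') (tpd := 1) (tpp := b') (c := c') (by simpa using hΔ') (by simp) (by simpa using hb') (by simpa using hc')
    obtain ⟨-, -, -, -, -, hwin⟩ := h
    push_cast at hwin
    have ht := vhFrac_73_200
    have hmono := vhFrac_anti (show (73 / 200 : ℝ) ≤ ((3781 : ℝ) / 10000) by norm_num)
    have hnu : ((60815 : ℝ) / 147456) ≤ ((23 : ℝ) / 40) := by norm_num
    linarith [hwin.1, ht.2]
  have hEh := (fermiEnergyOf_of_pointBracketCheck faceDirPt_NCCOK26_nH085_s3_lo_br (by norm_num) (by norm_num) (by norm_num) (ν := (23/40 : ℝ))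
    (by push_cast; exact ⟨le_rfl, le_rfl⟩)).2
  have hEv := (fermiEnergyOf_of_pointBracketCheck faceDirPt_NCCOK26_nH085_s3_hi_br (by norm_num) (by norm_num) (by norm_num) (ν := (23/40 : ℝ))
    (by push_cast; exact ⟨le_rfl, le_rfl⟩)).2
  push_cast at hEh hEv
  refine dWeightFace_fermiEnergyOf_mem_Icc_of_mem_box3_dir_num (Eh := ((2159 : ℝ) / 1000)) (Ev := ((7491 : ℝ) / 5000)) (Elow := ((7441 : ℝ) / 5000)) (κ₀ := 1 / 10) (κ := 1 / 10)
    (by norm_num) one_pos (by norm_num) (by norm_num) (by norm_num) hΔn hbn hcn (by norm_num) (by norm_num) hVH hEh.2 (by norm_num)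
    (by norm_num [faceU, fsD, fsN, cA]) (by norm_num [faceU, fsD, fsN, cA]) (by norm_num [faceU, fsD, fsN, cA]) (by norm_num [faceU, fsD, fsN, cA])
    hEv.1 (by norm_num) (by norm_num) (by norm_num [faceG]) (by norm_num) (by norm_num) (by norm_num) le_rfl (by norm_num [dWeightAxisCF])
    (by norm_num) (by norm_num) ?_ (by norm_num [dWeightFaceLoDec, faceRUp, faceN]) (by norm_num [dWeightFaceCF, faceN, faceR, fsN])
  intro D B C e hD hB hC he hG
  exact faceDirW_nonneg_of_mem_region ⟨le_trans (by norm_num) hD.1, le_trans hD.2 (by norm_num)⟩ ⟨le_trans (by norm_num) he.1, le_trans he.2 (by norm_num)⟩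
    ⟨le_trans (by norm_num) hB.1, le_trans hB.2 (by norm_num)⟩ ⟨le_trans (by norm_num) hC.1, le_trans hC.2 (by norm_num)⟩ hG

/-- **Slab 4 (t_pd ∈ [1.16, 1.29] eV) of `emeryBoxNCCOK26Src (EmeryBoxesKSlicesB)`, ν = 23/40: the antinodal Fermi-surface Cu-d weight of every member lies in `[0.4895, 0.6525]`**
(normalised-slab v2 corner rule; brackets `faceDirPt_NCCOK26_nH085_s4_lo_br` / `_hi_br`). [folklore] -/
theorem nCCOK26Box_dWeightFaceDir_nH085_s4 {Δ a b c : ℝ} (hΔ : Δ ∈ Icc (1 : ℝ) ((41 : ℝ) / 20)) (ha : a ∈ Icc ((29 : ℝ) / 25) ((129 : ℝ) / 100)) (hb : b ∈ Icc ((13 : ℝ) / 25) ((18 : ℝ) / 25)) (hc : c ∈ Icc ((1 : ℝ) / 50) ((1 : ℝ) / 50)) :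
    dWeightFace Δ a b c (fermiEnergyOf Δ a b c ((23 : ℝ) / 40)) ∈ Icc ((979 : ℝ) / 2000) ((261 : ℝ) / 400) := by
  have ha0 : 0 < a := lt_of_lt_of_le (by norm_num) ha.1
  rw [dWeightFace_fermiEnergyOf_eq_ratios ha0]
  have hΔn : Δ / a ∈ Icc ((100 : ℝ) / 129) ((205 : ℝ) / 116) := by
    constructor
    · rw [le_div_iff₀ ha0]; linarith [hΔ.1, ha.2]
    · rw [div_le_iff₀ ha0]; linarith [hΔ.2, ha.1]
  have hbn : b / a ∈ Icc ((52 : ℝ) / 129) ((18 : ℝ) / 29) := by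
    constructor
    · rw [le_div_iff₀ ha0]; linarith [hb.1, ha.2]
    · rw [div_le_iff₀ ha0]; linarith [hb.2, ha.1]
  have hcn : c / a ∈ Icc ((2 : ℝ) / 129) ((1 : ℝ) / 58) := by
    constructor
    · rw [le_div_iff₀ ha0]; linarith [hc.1, ha.2]
    · rw [div_le_iff₀ ha0]; linarith [hc.2, ha.1]
  have hVH : ∀ Δ' b' c' : ℝ, Δ' ∈ Icc ((100 : ℝ) / 129) ((205 : ℝ) / 116) → b' ∈ Icc ((52 : ℝ) / 129) ((18 : ℝ) / 29) → c' ∈ Icc ((2 : ℝ) / 129) ((1 : ℝ) / 58) →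
      1 - 2 * ((23 : ℝ) / 40) ≤ xVH Δ' 1 b' c' := by
    intro Δ' b' c' hΔ' hb' hc'
    have h := xVH_window_of_vhBoxCheck (Δ₁ := ((100 : ℚ) / 129)) (Δ₂ := ((205 : ℚ) / 116)) (a₁ := (1 : ℚ)) (a₂ := (1 : ℚ)) (b₁ := ((52 : ℚ) / 129)) (b₂ := ((18 : ℚ) / 29))
      (c₁ := ((2 : ℚ) / 129)) (c₂ := ((1 : ℚ) / 58)) (v₁ := ((513 : ℚ) / 400)) (v₂ := ((2031 : ℚ) / 1250)) (e := ((16219 : ℚ) / 10000)) (E := ((6423 : ℚ) / 5000))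
      (q₁ := ((699 : ℚ) / 2000)) (q₂ := ((2039 : ℚ) / 2500)) (by decide +kernel)
      (Δ := Δ') (tpd := 1) (tpp := b') (c := c') (by simpa using hΔ') (by simp) (by simpa using hb') (by simpa using hc')
    obtain ⟨-, -, -, -, -, hwin⟩ := h
    push_cast at hwin
    have ht := vhFrac_1_3
    have hmono := vhFrac_anti (show (1 / 3 : ℝ) ≤ ((699 : ℝ) / 2000) by norm_num)
    have hnu : ((61575 : ℝ) / 147456) ≤ ((23 : ℝ) / 40) := by norm_num
    linarith [hwin.1, ht.2]
  have hEh := (fermiEnergyOf_of_pointBracketCheck faceDirPt_NCCOK26_nH085_s4_lo_br (by norm_num) (by norm_num) (by norm_num) (ν := (23/40 : ℝ))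
    (by push_cast; exact ⟨le_rfl, le_rfl⟩)).2
  have hEv := (fermiEnergyOf_of_pointBracketCheck faceDirPt_NCCOK26_nH085_s4_hi_br (by norm_num) (by norm_num) (by norm_num) (ν := (23/40 : ℝ))
    (by push_cast; exact ⟨le_rfl, le_rfl⟩)).2
  push_cast at hEh hEv
  refine dWeightFace_fermiEnergyOf_mem_Icc_of_mem_box3_dir_num (Eh := ((4301 : ℝ) / 2000)) (Ev := ((15397 : ℝ) / 10000)) (Elow := ((15297 : ℝ) / 10000)) (κ₀ := 1 / 10) (κ := 1 / 10)
    (by norm_num) one_pos (by norm_num) (by norm_num) (by norm_num) hΔn hbn hcn (by norm_num) (by norm_num) hVH hEh.2 (by norm_num)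
    (by norm_num [faceU, fsD, fsN, cA]) (by norm_num [faceU, fsD, fsN, cA]) (by norm_num [faceU, fsD, fsN, cA]) (by norm_num [faceU, fsD, fsN, cA])
    hEv.1 (by norm_num) (by norm_num) (by norm_num [faceG]) (by norm_num) (by norm_num) (by norm_num) le_rfl (by norm_num [dWeightAxisCF])
    (by norm_num) (by norm_num) ?_ (by norm_num [dWeightFaceLoDec, faceRUp, faceN]) (by norm_num [dWeightFaceCF, faceN, faceR, fsN])
  intro D B C e hD hB hC he hG
  exact faceDirW_nonneg_of_mem_region ⟨le_trans (by norm_num) hD.1, le_trans hD.2 (by norm_num)⟩ ⟨le_trans (by norm_num) he.1, le_trans he.2 (by norm_num)⟩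
    ⟨le_trans (by norm_num) hB.1, le_trans hB.2 (by norm_num)⟩ ⟨le_trans (by norm_num) hC.1, le_trans hC.2 (by norm_num)⟩ hG

/-- **`emeryBoxNCCOK26Src (EmeryBoxesKSlicesB)`, ν = 23/40: for EVERY member θ the Cu-d weight of the antinodal Fermi-surface state lies in `[0.4845, 0.6838]`** (hull of the 4 t_pd slab windows; regime-free rule v2). [folklore] -/
theorem nCCOK26Box_dWeightFaceDir_nH085 {Δ a b c : ℝ} (hΔ : Δ ∈ Icc (1 : ℝ) ((41 : ℝ) / 20)) (ha : a ∈ Icc ((9 : ℝ) / 10) ((129 : ℝ) / 100)) (hb : b ∈ Icc ((13 : ℝ) / 25) ((18 : ℝ) / 25)) (hc : c ∈ Icc ((1 : ℝ) / 50) ((1 : ℝ) / 50)) :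
    dWeightFace Δ a b c (fermiEnergyOf Δ a b c ((23 : ℝ) / 40)) ∈ Icc ((969 : ℝ) / 2000) ((3419 : ℝ) / 5000) := by
  rcases le_or_gt a ((21 : ℝ) / 20) with h2 | h2
  · rcases le_or_gt a ((24 : ℝ) / 25) with h1 | h1
    · have h := nCCOK26Box_dWeightFaceDir_nH085_s1 hΔ ⟨ha.1, h1⟩ hb hc
      exact ⟨le_trans (by norm_num) h.1, le_trans h.2 (by norm_num)⟩
    · have h := nCCOK26Box_dWeightFaceDir_nH085_s2 hΔ ⟨h1.le, h2⟩ hb hc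
      exact ⟨le_trans (by norm_num) h.1, le_trans h.2 (by norm_num)⟩
  · rcases le_or_gt a ((29 : ℝ) / 25) with h3 | h3
    · have h := nCCOK26Box_dWeightFaceDir_nH085_s3 hΔ ⟨h2.le, h3⟩ hb hc
      exact ⟨le_trans (by norm_num) h.1, le_trans h.2 (by norm_num)⟩
    · have h := nCCOK26Box_dWeightFaceDir_nH085_s4 hΔ ⟨h3.le, ha.2⟩ hb hc
      exact ⟨le_trans (by norm_num) h.1, le_trans h.2 (by norm_num)⟩

end Summit.Ventures.CertifiedManyBodySolver.Downfold.Emery
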